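import Literature.GroupTheory.NormalSubgroupCompletionCentralizer
import Literature.GroupTheory.FreeNormalSubgroupCompletionSlim
import Literature.GroupTheory.SurfaceGroupProfiniteCompletionSlim
import Literature.IUT.HodgeTheaters.ProfiniteCompletionCentralizersCS
import Literature.IUT.HodgeTheaters.DiscreteProfiniteConjugatesThm26Holds
import Literature.IUT.HodgeTheaters.SurfaceGroupCompletionTorsionFree
import Literature.IUT.HodgeTheaters.DiscreteProfiniteConjugatesSurfaceFacts
import Literature.Topology.FourManifolds.SurfaceGroupResiduallyFinite
import Literature.Topology.FourManifolds.SurfaceGroupHomology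
import HarnessLib

/-!
# `C_{M̂}(η Λ) = 1` and slimness of `M̂` for an orientable SURFACE group `Λ ⊴ M` of finite index

Topic `Literature/GroupTheory` (abc-iut cell, campaign-L residual «J2»; [AbsTopIII] Lemma 4.3
"`Π_{[X/Aut X]}` is slim" as used in the proof of Prop. 4.2 (i), kurims p. 106 — here for a COMPACT
hyperbolic Riemann surface `X = ℍ/Λ̄`, `Λ̄` a cocompact torsion-free Fuchsian group, i.e. an orientable
surface group, `Π_{[X/Aut X]} = N_{PSL₂(ℝ)}(Λ̄)^`).

PROOF-ONLY companion (no definition, no named fact) of `NormalSubgroupCompletionCentralizer.lean`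
(abstract theorem `eq_one_of_forall_commute_toCompletion_of_hyps`) and of the FREE case
`FreeNormalSubgroupCompletionCentralizer.lean` / `FreeNormalSubgroupCompletionSlim.lean`.  The five
abstract hypotheses are DISCHARGED for an orientable surface group `Λ` (`IsOrientableSurfaceGroup`,
abc-iut-L5: `≃ ⟨a₁, b₁, …, a_g, b_g ∣ ∏ [aᵢ, bᵢ]⟩`, `g ≥ 2`) from theorems already in the tree:

* (CC) centraliser condition ⟸ hereditary conjugacy separability of orientable surface groups
  (`FreeOrSurface.hcs_surface_holds` — Stebe 1972 Thm 3.3, PROVED in the tree as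
  `surfaceGroupConjugacySeparable_holds`, with Riemann–Hurwitz `surfaceGroupFiniteIndexSubgroup_holds`)
  through `mem_closure_centralizer_of_commute_of_hcs` (abc-iut-L5, [IUTchI] §2 tool);
* (Z)  `Λ̂` slim: `isSlimGroup_profiniteCompletion_of_mulEquiv_surfaceGroup` ([AbsAnab] Lem. 1.3.1);
* (T)  `Λ̂` torsion-free: `IsOrientableSurfaceGroup.eq_one_of_pow_eq_one_profiniteCompletion`;
* (RF) `surfaceGroup_residuallyFinite`;
* (P)  the generator `a₁`: cyclic centraliser (`FreeOrSurface.isCyclic_centralizer_surfaceCase`) and the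
  `a₁`-coordinate of the abelianisation `SurfaceGroup.abelianize` (`a₁ ↦ 1`).

Results (all UNCONDITIONAL): `centralizerCondition_of_isOrientableSurfaceGroup`, `surfaceGroup_hyps`,
`eq_one_of_forall_commute_toCompletion_of_isOrientableSurfaceGroup` (`C_{M̂}(η Λ) = 1`),
`isSlimGroup_completion_of_isOrientableSurfaceGroup_normal` (`M̂` slim), the `IsFreeOrSurface`
dispatches `…_of_isFreeOrSurface` (free case = the tree's free-group files), and the NORMALISER shapes
`eq_one_of_forall_commute_etaFn_normalizer_of_isFreeOrSurface` /
`isSlimGroup_completion_normalizer_of_isFreeOrSurface` over Mathlib's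
`ProfiniteGrp.ProfiniteCompletion.completion (GrpCat.of ↥(N_N Γ))` (hypothesis shape of
abc-iut-L4-t14's `LocObj.isIdRigid_of_completion_normalizer`).  The consumer wiring at `X = ℍ/Γ̄`
(`C_{PSL₂(ℝ)}(Γ̄) = 1`, `[N(Γ̄) : Γ̄] < ∞`) is NOT here (abc-iut-L4-t14).

Classical group theory; OUR kernel check; nothing here bears on [IUTchIII] Cor. 3.12 or takes a side.
-/

noncomputable section

namespace Literature.GroupTheory

open Literature.AlgebraicGeometry.Frobenioids (IsSlimGroup)
open Literature.IUT.HodgeTheaters (profiniteCompletion toCompletion)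
open Literature.IUT.HodgeTheaters.ProfiniteCompletion
open CategoryTheory ProfiniteGrp ProfiniteGrp.ProfiniteCompletion
open _root_.Topology

universe u

variable {M : Type u} [Group M]

/-! ### The hypotheses (CC), (Z), (T), (RF), (P) for an orientable surface group -/

section Surface

open Literature.IUT.HodgeTheaters (IsOrientableSurfaceGroup IsFreeOrSurface IsFreeOfFiniteRank)

variable (Λ : Subgroup M) [Λ.FiniteIndex]

/-- (CC) for a finite-index subgroup that is an orientable surface group: the centraliser condition in
`M̂` for the elements of `Λ`, from HEREDITARY CONJUGACY SEPARABILITY of orientable surface groups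
(Stebe's theorem, proved in the tree: `FreeOrSurface.hcs_surface_holds`) through the tree's
`mem_closure_centralizer_of_commute_of_hcs`. [cite: Stebe1972, Thm 3.3 p.182] -/
theorem centralizerCondition_of_isOrientableSurfaceGroup (hΛ : IsOrientableSurfaceGroup Λ) :
    ∀ x ∈ Λ, ∀ σ : profiniteCompletion M, σ * toCompletion M x = toCompletion M x * σ →
      σ ∈ closure (toCompletion M '' (Subgroup.centralizer ({x} : Set M) : Set M)) := by
  intro x hx σ hσ
  refine mem_closure_centralizer_of_commute_of_hcs Λ (fun K hKΛ hK => ?_) hx σ hσ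
  haveI := hK
  exact hcs_subgroup_of_hcs Λ
    (fun K' hK' => Literature.IUT.HodgeTheaters.FreeOrSurface.hcs_surface_holds Λ hΛ K' hK') K hKΛ

/-- (Z), (T), (RF), (P) for an orientable surface group `L`: its profinite completion is slim (hence
centre-free) and torsion-free, `L` is residually finite, and the standard generator `a₁` has cyclic
centraliser `⟨a₁⟩` and maps to `1` under the `a₁`-coordinate of the abelianisation `L ↠ ℤ^{2g}`.
All inputs are theorems of the tree (`isSlimGroup_profiniteCompletion_of_mulEquiv_surfaceGroup`,
`IsOrientableSurfaceGroup.eq_one_of_pow_eq_one_profiniteCompletion`, `surfaceGroup_residuallyFinite`,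
`FreeOrSurface.isCyclic_centralizer_surfaceCase`, `SurfaceGroup.abelianize`).
[cite: MochizukiAbsAnab2004, Lemma 1.3.1 p.15] -/
theorem surfaceGroup_hyps (L : Type u) [Group L] (hL : IsOrientableSurfaceGroup L) :
    IsSlimGroup (profiniteCompletion L) ∧
    (∀ (z : profiniteCompletion L) (n : ℕ), 0 < n → z ^ n = 1 → z = 1) ∧
    Function.Injective (toCompletion L) ∧
    ∃ x : L, Subgroup.centralizer ({x} : Set L) = Subgroup.zpowers x ∧
      ∃ φ : L →* Multiplicative ℤ, φ x = Multiplicative.ofAdd 1 := by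
  obtain ⟨g, hg, ⟨e⟩⟩ :=
    Literature.IUT.HodgeTheaters.FreeOrSurface.exists_mulEquiv_fourManifoldsSurfaceGroup L hL
  refine ⟨isSlimGroup_profiniteCompletion_of_mulEquiv_surfaceGroup e hg,
    fun z n hn hz => hL.eq_one_of_pow_eq_one_profiniteCompletion z hn hz, ?_, ?_⟩
  · haveI := Literature.Topology.FourManifolds.surfaceGroup_residuallyFinite g
    haveI := Literature.IUT.HodgeTheaters.FreeOrSurface.residuallyFinite_of_mulEquiv e
    exact (etaFn_injective_iff_residuallyFinite (GrpCat.of L)).mpr inferInstance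
  · -- the generator `a₁` and the `a₁`-coordinate of the abelianisation
    have hg0 : 0 < g := by omega
    let i₀ : Literature.Topology.FourManifolds.surfaceGen g := (⟨0, hg0⟩, false)
    let x : L := e.symm (PresentedGroup.of i₀)
    let φ : L →* Multiplicative ℤ :=
      ((AddMonoidHom.toMultiplicative (Pi.evalAddMonoidHom (fun _ => ℤ) i₀)).comp
        (Literature.Topology.FourManifolds.SurfaceGroup.abelianize g)).comp e.toMonoidHom
    have hφx : φ x = Multiplicative.ofAdd 1 := by
      change AddMonoidHom.toMultiplicative (Pi.evalAddMonoidHom (fun _ => ℤ) i₀)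
        (Literature.Topology.FourManifolds.SurfaceGroup.abelianize g (e (e.symm (PresentedGroup.of i₀))))
        = _
      rw [MulEquiv.apply_symm_apply, Literature.Topology.FourManifolds.SurfaceGroup.abelianize_of]
      change Multiplicative.ofAdd
          ((Pi.single i₀ (1 : ℤ) : Literature.Topology.FourManifolds.surfaceGen g → ℤ) i₀) = _
      rw [Pi.single_eq_same]
    have hx1 : x ≠ 1 := by
      intro h
      have := hφx
      rw [h, map_one] at this
      exact absurd (congrArg Multiplicative.toAdd this) (by simp)
    exact ⟨x, centralizer_eq_zpowers_of_isCyclic_of_map_eq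
      (Literature.IUT.HodgeTheaters.FreeOrSurface.isCyclic_centralizer_surfaceCase L hL x hx1) φ hφx,
      φ, hφx⟩

variable [Λ.Normal]

/-- **`C_{M̂}(η Λ) = 1` for an orientable SURFACE group `Λ ⊴ M` of finite index with `C_M(Λ) = 1`**
([AbsTopIII] Lemma 4.3 input of Prop. 4.2 (i) for `X = ℍ/Λ̄` COMPACT, `M = N(Λ̄)`; companion of the
free case `eq_one_of_forall_commute_toCompletion`) — UNCONDITIONAL.
[cite: MochizukiAbsTopIII2015, Proposition 4.2 (i) proof p.106] -/
theorem eq_one_of_forall_commute_toCompletion_of_isOrientableSurfaceGroup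
    (hΛ : IsOrientableSurfaceGroup Λ) (hC : Subgroup.centralizer (Λ : Set M) = ⊥)
    (y : profiniteCompletion M) (hy : ∀ l ∈ Λ, y * toCompletion M l = toCompletion M l * y) :
    y = 1 := by
  obtain ⟨hslim, hT, hη, hx⟩ := surfaceGroup_hyps (Λ : Type u) hΛ
  refine eq_one_of_forall_commute_toCompletion_of_hyps Λ
    (centralizerCondition_of_isOrientableSurfaceGroup Λ hΛ) (fun z hz => ?_) hT hη hx hC y hy
  have h := hslim.centralizer_eq_bot ⊤ (by rw [Subgroup.coe_top]; exact isOpen_univ)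
  have hz' : z ∈ Subgroup.centralizer ((⊤ : Subgroup (profiniteCompletion Λ)) : Set _) := by
    rw [Subgroup.mem_centralizer_iff]
    exact fun w _ => hz w
  rwa [h, Subgroup.mem_bot] at hz'

/-- The same for `Λ` free of finite rank OR an orientable surface group (`IsFreeOrSurface`, "a group
as in [IUTchI] Theorem 2.6"): the free case is `eq_one_of_forall_commute_toCompletion`.
[cite: MochizukiAbsTopIII2015, Proposition 4.2 (i) proof p.106] -/
theorem eq_one_of_forall_commute_toCompletion_of_isFreeOrSurface
    (hΛ : IsFreeOrSurface Λ) (hC : Subgroup.centralizer (Λ : Set M) = ⊥)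
    (y : profiniteCompletion M) (hy : ∀ l ∈ Λ, y * toCompletion M l = toCompletion M l * y) :
    y = 1 := by
  rcases hΛ with hfree | hsurf
  · haveI := Literature.IUT.HodgeTheaters.FreeOrSurface.isFreeGroup_of_isFreeOfFiniteRank hfree
    exact eq_one_of_forall_commute_toCompletion Λ hC y hy
  · exact eq_one_of_forall_commute_toCompletion_of_isOrientableSurfaceGroup Λ hsurf hC y hy

/-- **`M̂` is SLIM** for `Λ ⊴ M` an orientable surface group of finite index with `C_M(Λ) = 1`.
[cite: MochizukiAbsTopIII2015, Proposition 4.2 (i) proof p.106] -/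
theorem isSlimGroup_completion_of_isOrientableSurfaceGroup_normal
    (hΛ : IsOrientableSurfaceGroup Λ) (hC : Subgroup.centralizer (Λ : Set M) = ⊥) :
    IsSlimGroup (profiniteCompletion M) :=
  isSlimGroup_completion_of_slim_of_centralizer_trivial Λ (surfaceGroup_hyps (Λ : Type u) hΛ).1
    (eq_one_of_forall_commute_toCompletion_of_isOrientableSurfaceGroup Λ hΛ hC)

/-- **`M̂` is SLIM** for `Λ ⊴ M` of finite index, free of finite rank or an orientable surface group,
with `C_M(Λ) = 1`. [cite: MochizukiAbsTopIII2015, Proposition 4.2 (i) proof p.106] -/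
theorem isSlimGroup_completion_of_isFreeOrSurface_normal
    (hΛ : IsFreeOrSurface Λ) (hC : Subgroup.centralizer (Λ : Set M) = ⊥) :
    IsSlimGroup (profiniteCompletion M) := by
  rcases hΛ with hfree | hsurf
  · haveI := Literature.IUT.HodgeTheaters.FreeOrSurface.isFreeGroup_of_isFreeOfFiniteRank hfree
    exact isSlimGroup_completion_of_isFreeGroup_normal Λ hC
  · exact isSlimGroup_completion_of_isOrientableSurfaceGroup_normal Λ hsurf hC

end Surface

/-! ### The normaliser shape -/

section Normalizer

open Literature.IUT.HodgeTheaters (IsFreeOrSurface)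

/-- **The normaliser shape** (hypothesis `h` of abc-iut-L4-t14's `LocObj.isIdRigid_of_completion_normalizer`
/ `HolRS.isIdRigid_mapsTo_pslQuotient_of_centralizer`): for `Γ ≤ N` free of finite rank or an
orientable surface group, of finite index in `N_N(Γ)`, with no nontrivial element of `N_N(Γ)`
centralising `Γ`, every element of the profinite completion of `N_N(Γ)` commuting with `η(Γ)` is
trivial. [cite: MochizukiAbsTopIII2015, Proposition 4.2 (i) proof p.106] -/
theorem eq_one_of_forall_commute_etaFn_normalizer_of_isFreeOrSurface {N : Type u} [Group N]
    (Γ : Subgroup N) [(Γ.subgroupOf (Subgroup.normalizer (Γ : Set N))).FiniteIndex]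
    (hΓ : IsFreeOrSurface Γ)
    (hC : ∀ g ∈ Subgroup.normalizer (Γ : Set N), (∀ γ ∈ Γ, g * γ = γ * g) → g = 1)
    (y : completion (GrpCat.of (Subgroup.normalizer (Γ : Set N))))
    (hy : ∀ γ : Subgroup.normalizer (Γ : Set N), (γ : N) ∈ Γ →
      y * etaFn (GrpCat.of (Subgroup.normalizer (Γ : Set N))) γ =
        etaFn (GrpCat.of (Subgroup.normalizer (Γ : Set N))) γ * y) : y = 1 := by
  let Λ : Subgroup (Subgroup.normalizer (Γ : Set N)) := Γ.subgroupOf (Subgroup.normalizer (Γ : Set N))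
  have eΛ : Λ ≃* Γ := Subgroup.subgroupOfEquivOfLe (Subgroup.le_normalizer (H := Γ))
  have hΛ : IsFreeOrSurface Λ := by
    rcases hΓ with ⟨n, ⟨e⟩⟩ | ⟨g, hg, ⟨e⟩⟩
    · exact Or.inl ⟨n, ⟨eΛ.trans e⟩⟩
    · exact Or.inr ⟨g, hg, ⟨eΛ.trans e⟩⟩
  have hCΛ : Subgroup.centralizer (Λ : Set (Subgroup.normalizer (Γ : Set N))) = ⊥ := by
    rw [eq_bot_iff]
    intro g hg
    rw [Subgroup.mem_centralizer_iff] at hg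
    rw [Subgroup.mem_bot]
    apply Subtype.ext
    refine hC g g.2 fun γ hγ => ?_
    have := hg ⟨γ, Subgroup.le_normalizer hγ⟩ (Subgroup.mem_subgroupOf.mpr hγ)
    exact (congrArg Subtype.val this).symm
  exact eq_one_of_forall_commute_toCompletion_of_isFreeOrSurface Λ hΛ hCΛ y
    fun l hl => hy l (Subgroup.mem_subgroupOf.mp hl)

/-- The slimness form: under the same hypotheses the profinite completion of `N_N(Γ)` is SLIM
([AbsTopIII] Lemma 4.3 for `Π_{[X/Aut X]}` with `X = ℍ/Γ̄`, `Γ̄` free OR cocompact torsion-free,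
given `[N(Γ̄) : Γ̄] < ∞` and `C(Γ̄) ∩ N(Γ̄) = 1`). [cite: MochizukiAbsTopIII2015, Proposition 4.2 (i) proof p.106] -/
theorem isSlimGroup_completion_normalizer_of_isFreeOrSurface {N : Type u} [Group N]
    (Γ : Subgroup N) [(Γ.subgroupOf (Subgroup.normalizer (Γ : Set N))).FiniteIndex]
    (hΓ : IsFreeOrSurface Γ)
    (hC : ∀ g ∈ Subgroup.normalizer (Γ : Set N), (∀ γ ∈ Γ, g * γ = γ * g) → g = 1) :
    IsSlimGroup (completion (GrpCat.of (Subgroup.normalizer (Γ : Set N)))) := by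
  let Λ : Subgroup (Subgroup.normalizer (Γ : Set N)) := Γ.subgroupOf (Subgroup.normalizer (Γ : Set N))
  have eΛ : Λ ≃* Γ := Subgroup.subgroupOfEquivOfLe (Subgroup.le_normalizer (H := Γ))
  have hΛ : IsFreeOrSurface Λ := by
    rcases hΓ with ⟨n, ⟨e⟩⟩ | ⟨g, hg, ⟨e⟩⟩
    · exact Or.inl ⟨n, ⟨eΛ.trans e⟩⟩
    · exact Or.inr ⟨g, hg, ⟨eΛ.trans e⟩⟩
  have hCΛ : Subgroup.centralizer (Λ : Set (Subgroup.normalizer (Γ : Set N))) = ⊥ := by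
    rw [eq_bot_iff]
    intro g hg
    rw [Subgroup.mem_centralizer_iff] at hg
    rw [Subgroup.mem_bot]
    apply Subtype.ext
    refine hC g g.2 fun γ hγ => ?_
    have := hg ⟨γ, Subgroup.le_normalizer hγ⟩ (Subgroup.mem_subgroupOf.mpr hγ)
    exact (congrArg Subtype.val this).symm
  exact isSlimGroup_completion_of_isFreeOrSurface_normal Λ hΛ hCΛ

end Normalizer

end Literature.GroupTheory

end
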